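import Summits.QuantumFields.BalabanUV.T4Continuum.Spine.NE1p.DressedSmallFieldMixedLetterWitness

/-!
# T⁴ programme, spine estimate NE1′ (node O3b/H2) — THE MIXED CUBE LETTER, part 3: ON PRINT's ANALYTICITY DOMAIN — the `n`-cube dictionary and
# N0k's END for table-free factors analytic on an OPEN POLYDISC NEIGHBOURHOOD of the closed polydisc `|σ(Δ)| ≤ e^{κ₁}` (p. 6 «an analytic function
# of s(Y₀), B, for |s(Y₀)| ≤ e^{κ₁}» — TYPE), NOT entire; GENUINE on a decided NON-ENTIRE non-product factor with a pole outside the polydisc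

Cell `pub-balaban`, sub-cell `t4`, row NE1′ formalisation crew (`t4/formal/NE1p/LEAVES.md` row W43 ∕ DAG N29zzb — a NEW row after ROW W39 ✓✓
(`DressedSmallFieldMixedLetter` p228238 + `…Witness` p228522); own-initiative under typer R-T61 (ii), INTENT journal l.18328, BOOKED R-T122 (ii) l.18351,
X-read X144; it answers X137's INFO-1∕INFO-2 (leaf-03-g11, l.18092∕l.18183: «`mixedLetter_rep` asks `Differentiable ℂ F` (jointly ENTIRE); print's TYPE
= analytic on the closed polydisc … a polydisc-local version is within reach by the same induction»)), unit `b2b-balaban-t4-ne1p-formalise-leaf-08`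
(gen 10).  ADDITIVE — imports part 2 `DressedSmallFieldMixedLetterWitness` ONLY (through it part 1, W34, W29,
the NE5 substrate `Support/B13TermContours`, N0k, W23, W25); 1 toy DATA `def` (`Floc`) + theorems + 1 `example`; 0 `def … : Prop`, 0 cite, 0 sorry;
part 1's `mixedDiff`∕`μS`∕`wS`∕`σS`∕cons-lemmas, part 2's `preF`∕`actF`∕`norm_preF_le`∕**`hL3_F`** (which never used analyticity) BY NAME — nothing restated.

WHAT THIS FILE DOES.
* §1 **`mixedLetter_rep_local`**: for radii `1 < r j < R j` and `F` ℂ-differentiable ON the open polydisc `Π_j {|σ_j| < R j}` ONLY,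
  `∫ wS·F∘σS d(⨂ μS S) = Δ_S F` — part 1's induction re-run with LOCAL bookkeeping: sections of a polydisc are polydiscs (`mapsTo_cons_right`,
  `mapsTo_cons_left` — vertices have modulus `≤ 1 < R j`), `differentiableOn_mixedDiff` from the VERTEX sections, measurability through
  CONTINUITY of `F∘σS` on the contour range (`continuous_σS`, `σS_mem_pi`), boundedness on the compact closed polydisc inside the domain, and the
  substrate's `integral_w₁_mul_eq_sub` with `U = ball 0 (R 0) ⊇ closedBall 0 (r 0)`; part 1's entire case is the `example`.
* §2 on W23's catalogue with `hF : ∀ Z, DifferentiableOn ℂ (F Z) (polydisc of radius R)`, `e^{κ₁} < R`: `hpre_F_local`, `hint_F_local`,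
  **`hrep_F_local`** ((B1) a THEOREM), **`muPart_fires_F_local`** = N0k `muPart_locE_le_of_linearDressing` ONCE BY NAME for all `κ₁ ≥ 6` with
  part 2's `hL3_F` UNCHANGED: `‖E_μ(univ) − E_0(univ)‖ ≤ (3∕16)·μ₀∕(1 − μ₀)`.
* §3 GENUINE: `Floc κ₁ Z σ = (4 − e^{−κ₁·#cubes₂ Z}·Π σ Δ)⁻¹` is analytic on the polydisc of radius `(3∕2)e^{κ₁}` (`differentiableOn_Floc`), bounded
  by `1` on the closed polydisc of radius `e^{κ₁}` (`norm_Floc_le`), **NOT entire** (`Floc_not_differentiable`: the pole `σ₀ = 4e^{κ₁}`), its mixed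
  letter is `(4 − e^{−κ₁ n})⁻¹ − 4⁻¹` (`mixedDiff_Floc`), and §2's END fires on it (`muPart_fires_Floc`) where part 2's cannot.

HONEST FRAMING.  TYPER RIDER (R-T122 (ii)(g), verbatim): «[folklore] several-variables bookkeeping (Fubini along `Fin.cons`, the substrate's one-variable
Cauchy letter on an OPEN disc, compactness of the closed polydisc, an ε∕δ non-continuity argument) on the substrate's CONTOUR OBJECTS over W23's decided
catalogue; the open-polydisc class strictly contains the entire class and contains OUR `Floc`; the identification with [Balaban1988RGII] p.6's domain is a
TYPE READING, the polydisc bound a HYPOTHESIS of (1.18)∕(1.21) TYPE — nothing of Bałaban's (2.14) factors constructed or bounded; (B1)∕(B3)∕(B5) NOT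
discharged ((B3) = G-ne9p2-5 UNPRINTED untouched); 0 binders instantiated on Bałaban's densities; wall v1.7 (T4-DAG v43) does NOT move».  Carried from
W39 (R-T115 (iii)(g)): «`mixedDiff` ∕ `μS` ∕ `wS` ∕ `σS` are OUR dictionary on the substrate's (row NE5) contour SPACE,
EQUAL to `lamJ` ∕ `wJ` ∕ `sigmaJ` at `S = univ` BY THEOREM; the polydisc bound `hB` is the toy's HYPOTHESIS carrying print's (1.18)∕(1.21) TYPE — not a
bound proved for Bałaban's operators; `Floc` is OUR decided factor; κ₁ ≥ 1 ∕ κ₁ ≥ 6 and the radius factor 3∕2 are OUR thresholds on OUR majorants and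
W23's numerals — no numeral of [Balaban1988RGII]; (B1)∕(B3) for (2.14) NOT discharged.»  [folklore] analysis (Fubini along `Fin.cons`, Cauchy through
the substrate's checked one-variable dictionary on an open disc, compactness) on the substrate's CONTOUR OBJECTS over W23's decided catalogue; the
identification of `F` with print's s(Δ)-dependent operator products ((1.10)∕(2.7), `H_k(s(Y₀),B′)`, the characteristic functions) and of the polydisc
with p. 6's analyticity domain is a TYPE READING; (B3) = GAPS G-ne9p2-5 UNPRINTED — NOT discharged, untouched; (B5) untouched; 0 binders instantiated
on Bałaban's densities ∕ operators ∕ (2.14) data ∕ `d_k` ∕ minimisers ∕ backgrounds; discharges no wall item; wall v1.7 (T4-DAG v43) does NOT move;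
R-t4r2-Q2 NOT met thereby; NE1′ ⇐ the named binders — NOT proved, NOT printed; spine PROVED 0∕9; count 9 unchanged.  Rung (B)+1 on ONE finite four-torus
— NOT infinite volume, NOT a mass gap, NOT OS on ℝ⁴, NOT Clay.  ABSOLUTE RULE honoured: the quotation is a LOCUS of the audited manuscript
[Balaban1988RGII] (CMP 116 (1988) 1–22, p. 6), TYPE∕CONTEXT only; nothing internally minted is cited; [folklore] tags on kernel lemmas only.  HONEST
DEPENDENCY: continuum YM on T⁴ ⇐ BetaPertH ∧ nine spine estimates (0/9 proved); BetaPertH ⇐ (D1) ∧ (D4) ∧ CAP+tail; G-an2-4 gates asym, D1 and NE2/3/4.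
-/

noncomputable section

namespace Summit.QuantumFields.BalabanUV.T4Continuum.NE1p.DressedSmallFieldMixedLetterLocal

open MeasureTheory Metric Set Complex Finset
open scoped BigOperators Function
open Summit.QuantumFields.BalabanUV.T4Continuum.B13TermContours
open Literature.MathematicalPhysics.QuantumFieldTheory.Balaban1983to89.B13Resummation (locE)
open Literature.Probability.LatticeModels (polyInc)
open Summit.QuantumFields.BalabanUV.T4Continuum.NE1p.DressedSmallFieldShape (muPart_locE_le_of_linearDressing)
open Summit.QuantumFields.BalabanUV.T4Continuum.NE1p.DressedSmallFieldPencilWitness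
  (Pol cubes₂ d₂ hloc₂ hd₂ h126₂ hvol₂ h227₂ hsmall₂ envelope₂_eq)
open Summit.QuantumFields.BalabanUV.T4Continuum.NE1p.DressedSmallFieldInductionWitness (exp_locE_univ)
open Summit.QuantumFields.BalabanUV.T4Continuum.NE1p.DressedSmallFieldContourWitness
  (linC cauchyLetter_rep ev ev_apply oR V₀M OM oR_mem norm_V₀M_le norm_OM_le)
open Summit.QuantumFields.BalabanUV.T4Continuum.NE1p.DressedSmallFieldCubeLetterWitness
  (one_lt_rexp μc νK cK cK_pos linK hlinw_K hl_K)
open Summit.QuantumFields.BalabanUV.T4Continuum.NE1p.DressedSmallFieldMixedLetter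
open Summit.QuantumFields.BalabanUV.T4Continuum.NE1p.DressedSmallFieldMixedLetterWitness
  (rK μc_eq_μS preF actF hB_σS norm_preF_le hL3_F)
open DressedSmallFieldPencilWitness.Pol

variable {n : ℕ}

/-! ## §1 THE `n`-CUBE LETTER FOR A FACTOR ANALYTIC ON AN OPEN POLYDISC `Π_j {|σ_j| < R j}` with `R j > r j` (print's TYPE), not entire -/

/-- [folklore] A vertex of the decoupling cube stays a vertex under `Fin.cons` of `0` or `1`. -/
theorem cons_vertex {c : ℂ} (hc : c = 0 ∨ c = 1) {z : Fin n → ℂ} (hz : ∀ j, z j = 0 ∨ z j = 1) (j : Fin (n + 1)) :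
    (Fin.cons c z : Fin (n + 1) → ℂ) j = 0 ∨ (Fin.cons c z : Fin (n + 1) → ℂ) j = 1 := by
  induction j using Fin.cases with
  | zero => simpa using hc
  | succ i => simpa using hz i

/-- [folklore] `Δ_S` is analytic ON A SET in a spectator variable as soon as every VERTEX section `σ ↦ F σ v` (`v ∈ {0,1}ⁿ`) is. -/
theorem differentiableOn_mixedDiff : ∀ (n : ℕ) (S : Finset (Fin n)) {F : ℂ → (Fin n → ℂ) → ℂ} {V : Set ℂ},
    (∀ z : Fin n → ℂ, (∀ j, z j = 0 ∨ z j = 1) → DifferentiableOn ℂ (fun σ => F σ z) V) →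
      DifferentiableOn ℂ (fun σ => mixedDiff n S (F σ)) V
  | 0, _, _, _, hF => by simpa [mixedDiff] using hF _ fun i => i.elim0
  | n + 1, S, F, V, hF => by
      have h1 : ∀ z : Fin n → ℂ, (∀ j, z j = 0 ∨ z j = 1) → DifferentiableOn ℂ (fun σ => F σ (Fin.cons 1 z)) V :=
        fun z hz => hF _ (cons_vertex (Or.inr rfl) hz)
      have h0 : ∀ z : Fin n → ℂ, (∀ j, z j = 0 ∨ z j = 1) → DifferentiableOn ℂ (fun σ => F σ (Fin.cons 0 z)) V :=
        fun z hz => hF _ (cons_vertex (Or.inl rfl) hz)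
      by_cases h : (0 : Fin (n + 1)) ∈ S
      · simp only [mixedDiff, if_pos h]
        exact (differentiableOn_mixedDiff n _ (F := fun σ z => F σ (Fin.cons 1 z)) h1).sub
          (differentiableOn_mixedDiff n _ (F := fun σ z => F σ (Fin.cons 0 z)) h0)
      · simp only [mixedDiff, if_neg h]
        exact differentiableOn_mixedDiff n _ (F := fun σ z => F σ (Fin.cons 0 z)) h0

/-- [folklore] The circle point is continuous in the angle. -/
theorem continuous_circ (r : ℝ) : Continuous (circ r) :=
  continuous_const.mul (Complex.continuous_exp.comp (Complex.continuous_ofReal.mul continuous_const))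

/-- [folklore] The contour configuration is continuous in the parameter. -/
theorem continuous_σS (r : Fin n → ℝ) (S : Finset (Fin n)) : Continuous (σS r S) :=
  continuous_pi fun j => by
    unfold σS σc; split_ifs
    · exact (continuous_circ _).comp (continuous_snd.comp (continuous_apply j))
    · exact continuous_const

/-- [folklore] A contour value lies STRICTLY inside any larger radius: `‖σc r S j x‖ < R j` if `0 ≤ r j < R j`. -/
theorem norm_σc_lt {r R : Fin n → ℝ} (hr : ∀ j, 0 ≤ r j) (hR : ∀ j, r j < R j) (S : Finset (Fin n)) (j : Fin n) (x : ℝ × ℝ) :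
    ‖σc r S j x‖ < R j := by
  unfold σc; split_ifs
  · rw [norm_circ (hr j)]; exact hR j
  · simpa using (hr j).trans_lt (hR j)

/-- [folklore] The contour configuration lies in the OPEN polydisc of any larger radii. -/
theorem σS_mem_pi {r R : Fin n → ℝ} (hr : ∀ j, 0 ≤ r j) (hR : ∀ j, r j < R j) (S : Finset (Fin n)) (p : Fin n → ℝ × ℝ) :
    σS r S p ∈ Set.univ.pi fun j => ball (0 : ℂ) (R j) :=
  Set.mem_univ_pi.2 fun j => mem_ball_zero_iff.2 (norm_σc_lt hr hR S j (p j))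

/-- [folklore] `z ↦ c ∷ z` maps the tail polydisc into the polydisc when `‖c‖ < R 0`. -/
theorem mapsTo_cons_right {R : Fin (n + 1) → ℝ} {c : ℂ} (hc : ‖c‖ < R 0) :
    MapsTo (fun z : Fin n → ℂ => (Fin.cons c z : Fin (n + 1) → ℂ)) (Set.univ.pi fun j => ball (0 : ℂ) (Fin.tail R j))
      (Set.univ.pi fun j => ball (0 : ℂ) (R j)) := fun z hz =>
  Set.mem_univ_pi.2 fun j => by
    induction j using Fin.cases with
    | zero => simpa using hc
    | succ i =>
        have h := Set.mem_univ_pi.1 hz i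
        simp only [Fin.cons_succ, Fin.tail] at h ⊢
        exact h

/-- [folklore] `σ ↦ σ ∷ v` maps the disc `|σ| < R 0` into the polydisc when `v` is a vertex and every `R j > 1`. -/
theorem mapsTo_cons_left {R : Fin (n + 1) → ℝ} (hR : ∀ j, 1 < R j) {v : Fin n → ℂ} (hv : ∀ j, v j = 0 ∨ v j = 1) :
    MapsTo (fun σ : ℂ => (Fin.cons σ v : Fin (n + 1) → ℂ)) (ball (0 : ℂ) (R 0)) (Set.univ.pi fun j => ball (0 : ℂ) (R j)) :=
  fun σ hσ => Set.mem_univ_pi.2 fun j => by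
    induction j using Fin.cases with
    | zero => simpa using hσ
    | succ i =>
        dsimp only
        rw [Fin.cons_succ, mem_ball_zero_iff]
        rcases hv i with h | h <;> simp [h, hR i.succ, zero_lt_one.trans (hR i.succ)]

/-- **THE `n`-CUBE LETTER ON PRINT's ANALYTICITY DOMAIN** (kernel; the induction of part 1's `mixedLetter_rep` re-run with LOCAL hypotheses): for radii
`1 < r j < R j` and `F : (Fin n → ℂ) → ℂ` ℂ-differentiable ON THE OPEN POLYDISC `Π_j {|σ_j| < R j}` — an open neighbourhood of the closed polydisc
`|σ(Δ)| ≤ r j` on whose distinguished boundary the contours run (print, p. 6: «an analytic function of s(Y₀), B, for |s(Y₀)| ≤ e^{κ₁}» — TYPE) —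
`∫ (Π_{j∈S} w₁ (r j) (p j))·F(σ_S(p)) d(⨂_j μS S j)(p) = Δ_S F`.  Sections of a polydisc are polydiscs: the tail section `z ↦ F(σ₀ ∷ z)` is analytic
on the tail polydisc (`‖σ₀‖ = r 0 < R 0`), the vertex sections `σ ↦ F(σ ∷ v)` on the disc `|σ| < R 0` (vertices have modulus `≤ 1 < R j`), so the
substrate's one-variable letter `integral_w₁_mul_eq_sub` applies with `U = ball 0 (R 0) ⊇ closedBall 0 (r 0)`. -/
theorem mixedLetter_rep_local : ∀ (n : ℕ) (r R : Fin n → ℝ) (S : Finset (Fin n)) (F : (Fin n → ℂ) → ℂ),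
    (∀ j, 1 < r j) → (∀ j, r j < R j) → DifferentiableOn ℂ F (Set.univ.pi fun j => ball (0 : ℂ) (R j)) →
      ∫ p, wS r S p * F (σS r S p) ∂(Measure.pi (μS S)) = mixedDiff n S F
  | 0, r, R, S, F, _, _, _ => by
      rw [Measure.pi_of_empty (μS S), integral_dirac]
      have h0 : ∀ p : Fin 0 → ℝ × ℝ, σS r S p = fun i => i.elim0 := fun p => funext fun i => i.elim0
      simp [wS, h0, mixedDiff]
  | n + 1, r, R, S, F, hr, hR, hF => by
      have hr' : ∀ j, 1 < Fin.tail r j := fun j => hr j.succ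
      have hR' : ∀ j, Fin.tail r j < Fin.tail R j := fun j => hR j.succ
      have hr0 : ∀ j, 0 ≤ r j := fun j => zero_le_one.trans (hr j).le
      have hR1 : ∀ j, 1 < R j := fun j => (hr j).trans (hR j)
      set G : (Fin (n + 1) → ℝ × ℝ) → ℂ := fun p => wS r S p * F (σS r S p) with hG
      -- (i) `G` is measurable and bounded (the contour configuration stays in the compact CLOSED polydisc inside the domain), hence integrable
      have hFσ : Continuous fun p : Fin (n + 1) → ℝ × ℝ => F (σS r S p) :=
        hF.continuousOn.comp_continuous (continuous_σS r S) (σS_mem_pi hr0 hR S)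
      have hGm : Measurable G := (measurable_wS r S).mul hFσ.measurable
      obtain ⟨B, hB⟩ : ∃ B, ∀ p, ‖F (σS r S p)‖ ≤ B := by
        have hK : IsCompact (Set.univ.pi fun j : Fin (n + 1) => closedBall (0 : ℂ) (r j)) :=
          isCompact_univ_pi fun j => isCompact_closedBall _ _
        obtain ⟨B, hB⟩ := hK.exists_bound_of_continuousOn
          (hF.continuousOn.mono (Set.pi_mono fun j _ => closedBall_subset_ball (hR j)))
        exact ⟨B, fun p => hB _ (Set.mem_univ_pi.2 fun j => mem_closedBall_zero_iff.2 (norm_σS_le hr0 S p j))⟩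
      have hGb : ∀ p, ‖G p‖ ≤ (∏ j, max (wB₁ (r j)) 1) * B := fun p => by
        rw [hG]; dsimp only; rw [norm_mul]
        exact mul_le_mul (norm_wS_le hr S p) (hB p) (norm_nonneg _)
          (Finset.prod_nonneg fun _ _ => zero_le_one.trans (le_max_right _ _))
      have hGi : Integrable G (Measure.pi (μS S)) :=
        Integrable.mono' (integrable_const _) hGm.aestronglyMeasurable (Filter.Eventually.of_forall hGb)
      -- (ii) Fubini along `Fin.cons`
      have hmp := (measurePreserving_piFinSuccAbove (μS S) 0).symm
      have hpi : (fun j : Fin n => μS S (Fin.succAbove 0 j)) = μS (tailSet S) := by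
        funext j; rw [Fin.succAbove_zero]; exact μS_succ S j
      rw [hpi] at hmp
      have he : ∀ q : (ℝ × ℝ) × (Fin n → ℝ × ℝ),
          (MeasurableEquiv.piFinSuccAbove (fun _ : Fin (n + 1) => ℝ × ℝ) 0).symm q = Fin.cons q.1 q.2 := by
        intro q
        simp only [MeasurableEquiv.piFinSuccAbove_symm_apply, Fin.insertNthEquiv, Fin.insertNth_zero, Equiv.coe_fn_mk]
        rfl
      have h1 : ∫ p, G p ∂(Measure.pi (μS S)) = ∫ q, G (Fin.cons q.1 q.2) ∂((μS S 0).prod (Measure.pi (μS (tailSet S)))) := by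
        rw [← hmp.integral_comp']
        exact integral_congr_ae (Filter.Eventually.of_forall fun q => by dsimp only; rw [he])
      have hint : Integrable (fun q : (ℝ × ℝ) × (Fin n → ℝ × ℝ) => G (Fin.cons q.1 q.2))
          ((μS S 0).prod (Measure.pi (μS (tailSet S)))) :=
        ((hmp.integrable_comp hGi.aestronglyMeasurable).2 hGi).congr
          (Filter.Eventually.of_forall fun q => by simp only [Function.comp_apply, he])
      have hcons : ∀ (x : ℝ × ℝ) (z : Fin n → ℝ × ℝ), G (Fin.cons x z) =
          cw r S 0 x * (wS (Fin.tail r) (tailSet S) z * F (Fin.cons (σc r S 0 x) (σS (Fin.tail r) (tailSet S) z))) :=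
        fun x z => by rw [hG]; dsimp only; rw [wS_cons, σS_cons]; ring
      -- (iii) inner integral: the induction hypothesis on the tail SECTION, analytic on the tail polydisc
      have hsec : ∀ x : ℝ × ℝ, DifferentiableOn ℂ (fun z : Fin n → ℂ => F (Fin.cons (σc r S 0 x) z))
          (Set.univ.pi fun j => ball (0 : ℂ) (Fin.tail R j)) := fun x =>
        hF.comp (differentiable_cons_right _).differentiableOn (mapsTo_cons_right (norm_σc_lt hr0 hR S 0 x))
      have hinner : ∀ x : ℝ × ℝ, ∫ z, G (Fin.cons x z) ∂(Measure.pi (μS (tailSet S))) =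
          cw r S 0 x * mixedDiff n (tailSet S) (fun z => F (Fin.cons (σc r S 0 x) z)) := fun x => by
        simp_rw [hcons]
        rw [integral_const_mul, mixedLetter_rep_local n (Fin.tail r) (Fin.tail R) (tailSet S)
          (fun z => F (Fin.cons (σc r S 0 x) z)) hr' hR' (hsec x)]
      rw [h1, integral_prod _ hint]
      dsimp only
      simp_rw [hinner]
      -- (iv) outer integral: the one-variable letter on the VERTEX sections (an active cube), the Dirac filler else
      by_cases h0 : (0 : Fin (n + 1)) ∈ S
      · have hμ0 : μS S 0 = lam₁ := if_pos h0
        have hcw : ∀ x, cw r S 0 x = w₁ (r 0) x := fun x => if_pos h0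
        have hσ : ∀ x : ℝ × ℝ, σc r S 0 x = circ (r 0) x.2 := fun x => if_pos h0
        have hH : DifferentiableOn ℂ (fun σ : ℂ => mixedDiff n (tailSet S) (fun z => F (Fin.cons σ z))) (ball (0 : ℂ) (R 0)) :=
          differentiableOn_mixedDiff n (tailSet S) (F := fun σ z => F (Fin.cons σ z)) fun v hv =>
            hF.comp (differentiable_cons_left v).differentiableOn (mapsTo_cons_left hR1 hv)
        have key := integral_w₁_mul_eq_sub (hr 0) isOpen_ball (closedBall_subset_ball (hR 0))
          (F := fun σ => mixedDiff n (tailSet S) (fun z => F (Fin.cons σ z))) hH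
        simp_rw [hμ0, hcw, hσ]
        rw [key]
        simp only [mixedDiff, if_pos h0]
      · have hμ0 : μS S 0 = Measure.dirac 0 := if_neg h0
        have hcw : ∀ x, cw r S 0 x = 1 := fun x => if_neg h0
        have hσ : ∀ x : ℝ × ℝ, σc r S 0 x = 0 := fun x => if_neg h0
        simp_rw [hμ0, hcw, hσ, one_mul]
        rw [integral_dirac]
        simp only [mixedDiff, if_neg h0]

/-- [folklore] Part 1's ENTIRE case is the special case of any radii `R > r`. -/
example (n : ℕ) (r : Fin n → ℝ) (S : Finset (Fin n)) (F : (Fin n → ℂ) → ℂ) (hr : ∀ j, 1 < r j) (hF : Differentiable ℂ F) :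
    ∫ p, wS r S p * F (σS r S p) ∂(Measure.pi (μS S)) = mixedDiff n S F :=
  mixedLetter_rep_local n r (fun j => r j + 1) S F hr (fun j => by linarith) hF.differentiableOn

/-! ## §2 N0k's END ON W23's CATALOGUE WITH `hF` LOCAL: analytic on the open polydisc of radius `R > e^{κ₁}` -/

variable {F : Pol → (Fin 2 → ℂ) → ℂ} {κ₁ R : ℝ}

/-- Socket `hpre` of N0k, local form: measurability through CONTINUITY of `p ↦ F Z(σ(p))` on the compact contour range. [folklore] -/
theorem hpre_F_local (hR : Real.exp κ₁ < R) (hF : ∀ Z, DifferentiableOn ℂ (F Z) (Set.univ.pi fun _ => ball (0 : ℂ) R)) (Z : Pol) :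
    AEStronglyMeasurable (preF F κ₁ Z) (νK Z) := by
  have hc : Continuous fun p : Fin 2 → ℝ × ℝ => F Z (σS (rK κ₁) (cubes₂ Z) p) :=
    (hF Z).continuousOn.comp_continuous (continuous_σS _ _)
      (σS_mem_pi (fun _ => (Real.exp_pos κ₁).le) (fun _ => hR) (cubes₂ Z))
  exact ((measurable_const.mul (((measurable_wS _ _).comp measurable_fst).mul (hc.measurable.comp measurable_fst))).mul
    ((measurable_w₁ 2).comp measurable_snd)).aestronglyMeasurable

/-- Socket `hint` of N0k, local form. [folklore] -/
theorem hint_F_local (hκ : 0 < κ₁) (hR : Real.exp κ₁ < R) (hF : ∀ Z, DifferentiableOn ℂ (F Z) (Set.univ.pi fun _ => ball (0 : ℂ) R))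
    (hB : ∀ Z σ, (∀ Δ, ‖σ Δ‖ ≤ Real.exp κ₁) → ‖F Z σ‖ ≤ 1) (Z : Pol) (κ : ℝ) :
    Integrable (fun ω => ‖preF F κ₁ Z ω‖ * Real.exp κ) (νK Z) :=
  Integrable.mono' (integrable_const (cK * (max (wB₁ (Real.exp κ₁)) 1) ^ 2 * wB₁ 2 * Real.exp κ))
    ((hpre_F_local hR hF Z).norm.mul aestronglyMeasurable_const)
    (Filter.Eventually.of_forall fun ω => by
      rw [Real.norm_of_nonneg (by positivity)]
      exact mul_le_mul_of_nonneg_right (norm_preF_le hκ hB Z ω) (Real.exp_pos κ).le)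

/-- **(B1) `hrep` FOR THE JOINT-FACTOR TERM WITH `hF` LOCAL** (kernel; §1 `mixedLetter_rep_local` at radii `e^{κ₁} < R` × W29 `cauchyLetter_rep`):
the factor need only be analytic on the open polydisc of radius `R` — print's domain TYPE. -/
theorem hrep_F_local (hκ : 0 < κ₁) (hR : Real.exp κ₁ < R) (hF : ∀ Z, DifferentiableOn ℂ (F Z) (Set.univ.pi fun _ => ball (0 : ℂ) R))
    (s : ℂ) (Z : Pol) :
    actF F s Z = ∑ j ∈ ({Z} : Finset Pol), ∫ ω, preF F κ₁ j ω * cexp (linK j ω (V₀M + s • OM)) ∂(νK j) := by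
  rw [Finset.sum_singleton]
  have h1 : ∀ ω : (Fin 2 → ℝ × ℝ) × (ℝ × ℝ), preF F κ₁ Z ω * cexp (linK Z ω (V₀M + s • OM)) =
      ((cK : ℂ) * (wS (rK κ₁) (cubes₂ Z) ω.1 * F Z (σS (rK κ₁) (cubes₂ Z) ω.1))) *
        (w₁ 2 ω.2 * cexp (linC 2 (ev Z) ω.2 (V₀M + s • OM))) := fun ω => by
    simp only [preF, linK]; ring
  simp_rw [h1]
  rw [νK, integral_prod_mul (f := fun p : Fin 2 → ℝ × ℝ => (cK : ℂ) * (wS (rK κ₁) (cubes₂ Z) p * F Z (σS (rK κ₁) (cubes₂ Z) p)))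
    (g := fun q : ℝ × ℝ => w₁ 2 q * cexp (linC 2 (ev Z) q (V₀M + s • OM))), cauchyLetter_rep one_lt_two, ev_apply,
    integral_const_mul, μc_eq_μS, mixedLetter_rep_local 2 (rK κ₁) (fun _ => R) (cubes₂ Z) (F Z) (fun _ => one_lt_rexp hκ)
    (fun _ => hR) (hF Z), actF]

/-- **N0k's END FIRES WITH `hF` LOCAL** (ONE application BY NAME; `hL3 := ` part 2's `hL3_F` UNCHANGED — it never used analyticity; `hrep := hrep_F_local`):
for every `κ₁ ≥ 6`, every `R > e^{κ₁}` and every family `F` analytic on the open polydisc of radius `R` and bounded by `1` on the closed polydisc of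
radius `e^{κ₁}`, `‖E_μ(univ) − E_0(univ)‖ ≤ e·1·1·(3∕2)²·(1∕12)·e^{−1·1}·μ₀∕(1 − μ₀)`. -/
theorem muPart_fires_F_local (hκ : 6 ≤ κ₁) (hR : Real.exp κ₁ < R)
    (hF : ∀ Z, DifferentiableOn ℂ (F Z) (Set.univ.pi fun _ => ball (0 : ℂ) R))
    (hB : ∀ Z σ, (∀ Δ, ‖σ Δ‖ ≤ Real.exp κ₁) → ‖F Z σ‖ ≤ 1) {μ₀ : ℝ} {μ : ℂ} (h0 : 0 < μ₀) (h01 : μ₀ < 1) (hμ : ‖μ‖ ≤ μ₀) :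
    ‖locE (polyInc on cubes₂) cubes₂ (actF F μ) univ - locE (polyInc on cubes₂) cubes₂ (actF F 0) univ‖ ≤
      Real.exp 1 * 1 * 1 * (3 / 2) ^ 2 * (1 / 12) * Real.exp (-(1 * 1)) * (μ₀ / (1 - μ₀)) :=
  muPart_locE_le_of_linearDressing (polyInc on cubes₂) (reach := cubes₂) (d := d₂) (ν' := νK) (pre := preF F κ₁)
    (lin := linK) (l := fun _ _ => 2) (V₀ := V₀M) (O := OM) (terms := fun Z => {Z}) (act := actF F) (A := 1 / 12)
    (R := κ₁ - 1) (r₁ := 1) (κ₀ := 1) (K₀ := 3 / 2) (c₁ := 1) (c := 1) (b := 1) (ν := 1) (dX := 1) (μ₁ := 1) (ε₁ := 1 / 8)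
    (b₀ := 1 / 8) hloc₂ (fun Z => by rw [one_mul]) hd₂ (by norm_num) (by norm_num) (by norm_num) (by norm_num) (by norm_num)
    (by norm_num) (by norm_num) (by norm_num) h126₂ hvol₂ h227₂ (by linarith) hsmall₂ univ_nonempty
    (fun s _ Z => hrep_F_local (by linarith) hR hF s Z) (hpre_F_local hR hF) hlinw_K hl_K
    (fun Z => hint_F_local (by linarith) hR hF hB Z _) norm_V₀M_le norm_OM_le (by norm_num) (hL3_F (by linarith) hB) h0 h01 hμ

/-- The same END in closed numerals (W23 `envelope₂_eq`): `≤ (3∕16)·μ₀∕(1 − μ₀)`. -/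
theorem muPart_fires_F_local' (hκ : 6 ≤ κ₁) (hR : Real.exp κ₁ < R)
    (hF : ∀ Z, DifferentiableOn ℂ (F Z) (Set.univ.pi fun _ => ball (0 : ℂ) R))
    (hB : ∀ Z σ, (∀ Δ, ‖σ Δ‖ ≤ Real.exp κ₁) → ‖F Z σ‖ ≤ 1) {μ₀ : ℝ} {μ : ℂ} (h0 : 0 < μ₀) (h01 : μ₀ < 1) (hμ : ‖μ‖ ≤ μ₀) :
    ‖locE (polyInc on cubes₂) cubes₂ (actF F μ) univ - locE (polyInc on cubes₂) cubes₂ (actF F 0) univ‖ ≤ 3 / 16 * (μ₀ / (1 - μ₀)) := by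
  rw [← envelope₂_eq]; exact muPart_fires_F_local hκ hR hF hB h0 h01 hμ

/-! ## §3 GENUINE on a decided NON-ENTIRE, NON-PRODUCT factor: a pole on `Π σ Δ = 4e^{κ₁·#cubes}`, outside the polydisc of radius `(3∕2)·e^{κ₁}` -/

/-- THE DECIDED LOCAL FACTOR `Floc κ₁ Z σ := (4 − e^{−κ₁·#cubes₂ Z}·Π_{Δ∈cubes₂ Z} σ Δ)⁻¹` — analytic where `|e^{−κ₁ n}Π σ| < 4`, in particular on the open
polydisc of radius `(3∕2)·e^{κ₁}`; `‖Floc‖ ≤ 1∕3` on the closed polydisc of radius `e^{κ₁}`; NOT entire (a pole at `σ ≡ 4e^{κ₁}` on the cube-`0` polymer). -/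
def Floc (κ₁ : ℝ) (Z : Pol) (σ : Fin 2 → ℂ) : ℂ := (4 - (Real.exp (-(κ₁ * (cubes₂ Z).card)) : ℂ) * ∏ Δ ∈ cubes₂ Z, σ Δ)⁻¹

/-- [folklore] The normalised coupling monomial on a polydisc of radius `ρ·e^{κ₁}` has modulus `≤ ρ^{#cubes₂ Z}`. -/
theorem norm_cpl_le (κ₁ : ℝ) (Z : Pol) {σ : Fin 2 → ℂ} {ρ : ℝ} (hσ : ∀ Δ, ‖σ Δ‖ ≤ ρ * Real.exp κ₁) :
    ‖(Real.exp (-(κ₁ * (cubes₂ Z).card)) : ℂ) * ∏ Δ ∈ cubes₂ Z, σ Δ‖ ≤ ρ ^ (cubes₂ Z).card := by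
  rw [norm_mul, Complex.norm_real, Real.norm_of_nonneg (Real.exp_pos _).le, norm_prod]
  calc Real.exp (-(κ₁ * (cubes₂ Z).card)) * ∏ Δ ∈ cubes₂ Z, ‖σ Δ‖
      ≤ Real.exp (-(κ₁ * (cubes₂ Z).card)) * ∏ _Δ ∈ cubes₂ Z, (ρ * Real.exp κ₁) :=
        mul_le_mul_of_nonneg_left (Finset.prod_le_prod (fun _ _ => norm_nonneg _) fun Δ _ => hσ Δ) (Real.exp_pos _).le
    _ = ρ ^ (cubes₂ Z).card * (Real.exp (-(κ₁ * (cubes₂ Z).card)) * Real.exp ((cubes₂ Z).card * κ₁)) := by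
        rw [Finset.prod_const, mul_pow, ← Real.exp_nat_mul]; ring
    _ = ρ ^ (cubes₂ Z).card := by rw [← Real.exp_add, show -(κ₁ * ((cubes₂ Z).card : ℝ)) + (cubes₂ Z).card * κ₁ = 0 by ring, Real.exp_zero, mul_one]

/-- [folklore] The catalogue's polymers have at most two cubes. -/
theorem card_cubes₂_le (Z : Pol) : (cubes₂ Z).card ≤ 2 := (Finset.card_le_univ _).trans (by simp)

/-- **Admissibility `hF` LOCAL: `Floc` is analytic on the open polydisc of radius `(3∕2)·e^{κ₁} > e^{κ₁}`** (there `|e^{−κ₁ n}Π σ| ≤ (3∕2)² < 4`). [folklore] -/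
theorem differentiableOn_Floc (κ₁ : ℝ) (Z : Pol) :
    DifferentiableOn ℂ (Floc κ₁ Z) (Set.univ.pi fun _ => ball (0 : ℂ) (3 / 2 * Real.exp κ₁)) := by
  have hd : Differentiable ℂ fun σ : Fin 2 → ℂ => (4 : ℂ) - (Real.exp (-(κ₁ * (cubes₂ Z).card)) : ℂ) * ∏ Δ ∈ cubes₂ Z, σ Δ :=
    ((DressedSmallFieldMixedLetterWitness.differentiable_cpl Z).const_mul _).const_sub _
  refine DifferentiableOn.inv hd.differentiableOn fun σ hσ h0 => ?_
  have hle := norm_cpl_le κ₁ Z (ρ := 3 / 2) fun Δ => (mem_ball_zero_iff.1 (Set.mem_univ_pi.1 hσ Δ)).le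
  have h94 : ((3 : ℝ) / 2) ^ (cubes₂ Z).card ≤ (3 / 2) ^ 2 := pow_le_pow_right₀ (by norm_num) (card_cubes₂_le Z)
  rw [sub_eq_zero] at h0
  rw [← h0] at hle
  norm_num at hle h94
  linarith

/-- **Admissibility `hB`: `‖Floc‖ ≤ 1` (indeed `≤ 1∕3`) on the closed polydisc of radius `e^{κ₁}`.** [folklore] -/
theorem norm_Floc_le (κ₁ : ℝ) (Z : Pol) {σ : Fin 2 → ℂ} (hσ : ∀ Δ, ‖σ Δ‖ ≤ Real.exp κ₁) : ‖Floc κ₁ Z σ‖ ≤ 1 := by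
  have hp := norm_cpl_le κ₁ Z (σ := σ) (ρ := 1) fun Δ => by simpa using hσ Δ
  rw [one_pow] at hp
  have h2 : (3 : ℝ) ≤ ‖(4 : ℂ) - (Real.exp (-(κ₁ * (cubes₂ Z).card)) : ℂ) * ∏ Δ ∈ cubes₂ Z, σ Δ‖ := by
    have := norm_sub_norm_le (4 : ℂ) ((Real.exp (-(κ₁ * (cubes₂ Z).card)) : ℂ) * ∏ Δ ∈ cubes₂ Z, σ Δ)
    have h4 : ‖(4 : ℂ)‖ = 4 := by simp
    linarith
  rw [Floc, norm_inv]
  exact inv_le_one_of_one_le₀ (by linarith)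

/-- **`Floc` IS NOT ENTIRE** (so part 2's END does not apply to it — part 3's does): on the cube-`0` polymer it blows up at the pole `σ₀ = 4e^{κ₁}` —
continuity there would bound `‖(4 − e^{−κ₁}σ₀)⁻¹‖` by `1` near the pole, but along `σ₀ = 4e^{κ₁} − t·e^{κ₁}`, `0 < t ≤ 1`, it equals `1∕t ≥ 1`. -/
theorem Floc_not_differentiable (κ₁ : ℝ) : ¬ Differentiable ℂ (Floc κ₁ p0) := by
  intro hdiff
  set a : ℂ := ((4 * Real.exp κ₁ : ℝ) : ℂ) with ha
  have hcont : ContinuousAt (Floc κ₁ p0) (fun _ => a) := (hdiff _).continuousAt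
  have hval : ∀ t : ℝ, Floc κ₁ p0 (fun _ => a - (t * Real.exp κ₁ : ℝ)) = ((t⁻¹ : ℝ) : ℂ) := by
    intro t
    simp only [Floc, cubes₂, Finset.prod_singleton, Finset.card_singleton, Nat.cast_one, mul_one, ha]
    push_cast
    rw [show (4 : ℂ) - cexp (-(κ₁ : ℂ)) * (4 * cexp (κ₁ : ℂ) - (t : ℂ) * cexp (κ₁ : ℂ)) =
      (t : ℂ) * (cexp (-(κ₁ : ℂ)) * cexp (κ₁ : ℂ)) + 4 * (1 - cexp (-(κ₁ : ℂ)) * cexp (κ₁ : ℂ)) by ring,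
      ← Complex.exp_add, neg_add_cancel, Complex.exp_zero]
    ring
  have h0 : Floc κ₁ p0 (fun _ => a) = 0 := by simpa using hval 0
  rw [Metric.continuousAt_iff] at hcont
  obtain ⟨δ, hδ, hδ'⟩ := hcont 1 one_pos
  have hE := Real.exp_pos κ₁
  set t : ℝ := min (δ / (2 * Real.exp κ₁)) 1 with ht
  have htpos : 0 < t := by rw [ht]; positivity
  have ht1 : t ≤ 1 := min_le_right _ _
  have htE : t * Real.exp κ₁ ≤ δ / 2 := by
    have h := min_le_left (δ / (2 * Real.exp κ₁)) 1
    rw [← ht, le_div_iff₀ (by positivity)] at h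
    linarith
  have hdist : dist (fun _ : Fin 2 => a - (t * Real.exp κ₁ : ℝ)) (fun _ => a) < δ := by
    rw [dist_pi_lt_iff hδ]
    intro _
    rw [dist_eq_norm, sub_sub_cancel_left, norm_neg, Complex.norm_real, Real.norm_of_nonneg (by positivity)]
    linarith
  have h1 := hδ' hdist
  rw [hval, h0, dist_zero_right, Complex.norm_real, Real.norm_of_nonneg (inv_pos.2 htpos).le] at h1
  have : (1 : ℝ) ≤ t⁻¹ := (le_inv_comm₀ one_pos htpos).2 (by rwa [inv_one])
  linarith

/-- **THE MIXED LETTER OF THE LOCAL FACTOR** on every polymer: `Δ_{cubes₂ Z} Floc = (4 − e^{−κ₁ n})⁻¹ − 4⁻¹` (the other vertices give `4⁻¹` each). -/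
theorem mixedDiff_Floc (κ₁ : ℝ) : ∀ Z : Pol,
    mixedDiff 2 (cubes₂ Z) (Floc κ₁ Z) = ((4 : ℂ) - (Real.exp (-(κ₁ * (cubes₂ Z).card)) : ℂ))⁻¹ - 4⁻¹
  | p0 => by rw [show cubes₂ p0 = {0} from rfl, mixedDiff_zero]; simp [Floc, cubes₂]
  | p1 => by rw [show cubes₂ p1 = {1} from rfl, mixedDiff_one]; simp [Floc, cubes₂]
  | p01 => by rw [show cubes₂ p01 = {0, 1} from rfl, mixedDiff_pair]; simp [Floc, cubes₂]

/-- **THE END ON THE DECIDED LOCAL FACTOR, in closed numerals** (part 3's END; part 2's is not applicable — `Floc` is not entire): for every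
`κ₁ ≥ 6`, `‖E_μ(univ) − E_0(univ)‖ ≤ (3∕16)·μ₀∕(1 − μ₀)`. -/
theorem muPart_fires_Floc (hκ : 6 ≤ κ₁) {μ₀ : ℝ} {μ : ℂ} (h0 : 0 < μ₀) (h01 : μ₀ < 1) (hμ : ‖μ‖ ≤ μ₀) :
    ‖locE (polyInc on cubes₂) cubes₂ (actF (Floc κ₁) μ) univ -
        locE (polyInc on cubes₂) cubes₂ (actF (Floc κ₁) 0) univ‖ ≤ 3 / 16 * (μ₀ / (1 - μ₀)) :=
  muPart_fires_F_local' hκ (by linarith [Real.exp_pos κ₁] : Real.exp κ₁ < 3 / 2 * Real.exp κ₁) (differentiableOn_Floc κ₁)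
    (fun Z _ hσ => norm_Floc_le κ₁ Z hσ) h0 h01 hμ

end Summit.QuantumFields.BalabanUV.T4Continuum.NE1p.DressedSmallFieldMixedLetterLocal

end
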